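import Summits.BirchSwinnertonDyer.Rank1Residual.X2.GreenbergVatsalSelmerLink
import Literature.NumberTheory.EllipticCurves.OrdinaryLocalReductionMapProofs
import Literature.NumberTheory.EllipticCurves.SerreOpenImageOrdinaryInertiaProofs
import Literature.NumberTheory.EllipticCurves.KodairaNeronUnramifiedInertiaProofs
import Literature.NumberTheory.EllipticCurves.SelmerFiniteProofs
import HarnessLib

/-!
# Greenberg's datum `C_p = ker(E[p^∞] → Ẽ(𝔽̄_p))` of a good prime of `E/ℚ`, IN THE KERNEL:
# `D_p`-stability, GV's hypothesis "`I_p` acts trivially on `D`" and the Kummer compatibility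
# DISCHARGED from the tree's reduction map; hence `Sel_{p^∞}(E/ℚ_∞) ⊆ S^{Σ₀}_{E[p^∞]}(ℚ_∞)` and the
# `E(ℚ)[p]`-corrected comparison with NO hypothesis on the datum

HONEST FRAMING (cell `b2b-bsdres`, run/shared/lean/b2b/bsd-rank1-residual/, verbatim in every
file): the goal of the cell is to DELETE the COMBINATION-SHAPED residual classes of the
Birch–Swinnerton-Dyer formula for ALL analytic-rank `≤ 1` elliptic curves over `ℚ` — "full BSD
formula for every rank `≤ 1` curve in class `C`" assembled STRICTLY from published theorems — so
that the rank-`≤ 1` remainder becomes exactly the CONSTRUCTION-SHAPED classes, which are TYPED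
(missing-input `Prop`s), NOT attempted. This is not "finishing BSD". Sub-cell
`b2b-bsdres-eisenstein-p2` (CLASS-OWNERS row "X2"), gen 9: research route; NO CLAIM BEYOND STATED
CLASSES; nothing here changes a label. Four definitions WITH BODIES (`specVal`, `localRed`,
`reductionDatum`, `reductionData` — Greenberg's own objects, no `Prop`-valued def, nothing asserted)
and theorems; NO named fact.

GREENBERG–VATSAL p. 26 (arXiv:math/9906215; Invent. Math. 142 (2000)): "Assume that `E` has good
ordinary reduction at `p`. Then viewing `A` as a `G_{ℚ_p}`-module, we define
`C = ker(E[p^∞] → Ẽ[p^∞])`, where `Ẽ` is the reduction of `E` modulo `p`. Then `D = Ẽ[p^∞]` is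
unramified as a `G_{ℚ_p}`-module … In [Gre99], one can find a proof that `im(κ_p) = L_p`. This result,
together with the fact that `im(κ_η) = 0` for all primes `η` of `ℚ_∞` not lying over `p`, implies
that `Sel_E(ℚ_∞)_p = S_A(ℚ_∞)`. The nonprimitive Selmer groups `Sel^{Σ₀}_E(ℚ_∞)_p` and
`S^{Σ₀}_A(ℚ_∞)` also coincide". THIS FILE builds that `C` for a globally minimal `E/ℚ` at a prime
`p ∤ Δ_E` as a `GreenbergSelmer.LocalDatum` on `E[p^∞] = W.geomPrimaryTorsion p`, from the tree's
reduction homomorphism `E(K̄_v) → Ẽ(k̄_v)` of the minimal model over the valuation ring of the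
spectral valuation of `K̄_v` (`goodReductionHom`, `localIntModel_baseChange`,
`OrdinaryLocalReductionMapProofs` — Silverman VII.2.1), and PROVES:
* `localRed_smul_of_mem_absInertia` — the local inertia group does not change reductions
  (`reducePoint_congrEquiv_smul_eq_of_val` + `mem_inertia_iff_spectralValuation` +
  `inertia_eq_absInertia`): "`D = Ẽ[p^∞]` is unramified";
* `reductionDatum` — `C_v = E[p^∞] ∩ ker red_v` is `D_v`-stable (`localRed_smul_eq_zero_iff`);
* **`reductionDatum_htriv`** — GV's hypothesis "`I_p` acts trivially on `D`" (the `htriv` of every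
  gen-8 comparison theorem `GreenbergVatsalTorsion*.natCard_gvSelmer_torsion*`) HOLDS for `C_v`;
* **`reductionDatum_kummer`** — the Kummer compatibility of `GreenbergVatsalSelmerLink` (`σP - P`
  torsion, `σ ∈ I_{ℚ_v}`, `P ∈ E(K̄_v)` ⟹ `σP - P ∈ C_v`: `red(σP) = red(P)`) HOLDS for `C_v` —
  Greenberg's `im(κ_p) ⊆ L_p` in the direction needed for an inclusion;
* **`selmerInfty_le_gvSelmerInfty_reductionData`** — `Sel_{p^∞}(E/ℚ_∞) ⊆ S^{Σ₀}_{E[p^∞]}(ℚ_∞)`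
  (GV (6)) with NO hypothesis on the datum, for every `ℤ_p`-extension and every `Σ₀ ⊇` bad primes:
  referee R102.2 (b) (`gvSelmer-SelmerDualData-link`) — the Selmer group whose Pontryagin dual is
  `SelmerDualData.X` (route G's `D.X`) sits inside the object of the kernel comparison;
* **`natCard_gvSelmerInfty_torsion_reductionData`** — gen 8's `E(ℚ)[p]`-corrected GV Prop. (2.8)
  `#S^{Σ₀}_{E[p]}(ℚ_∞) = #S^{Σ₀}_{E[p^∞]}(ℚ_∞)[p] · #E(ℚ_∞)[p^∞][p]` for Greenberg's datum at an odd
  good ordinary `p`, `κ` cyclotomic, now with NO hypothesis on the datum at all.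
On `Σ₀ ⊇ Ram(E[p^∞])` (GV Prop. (2.5), referee R102.2 (a)): the standing hypothesis `hS` ("every
finite `v ∉ Σ₀` with `v ∤ p` is good") gives `Ram(E[p^∞]) ∖ {p} ⊆ Σ₀` by Silverman VII.4.1(a), in
the kernel as `GreenbergVatsalTorsionCurve.unramified_outside`; route G takes
`Σ₀ = {ℓ ∣ N₁N₂, ℓ ≠ p}`.
WHAT STAYS PRINTED: `im(κ_p) = L_p` with EQUALITY (Greenberg LNM 1716 Props. 2.1–2.4), GV Cor. (2.3),
Prop. (2.4), Prop. (2.5) ("Let `p` be an odd prime. Assume that `S_A(ℚ_∞)` is `Λ`-cotorsion and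
that `D` is unramified for the action of `G_{ℚ_p}`. Suppose that `Σ₀` is a subset of `Σ − {p, ∞}`
which contains `Ram(A)`. Then `S^{Σ₀}_A(ℚ_∞)^` has no nonzero, finite `Λ`-submodules." — p. 23; NO
`H⁰`/torsion clause) and the multiplicative-prime datum (Tate curve, GV pp. 14–15).

References: Greenberg–Vatsal 2000, §2 pp. 14, 19, 23, 25–26; Greenberg, LNM 1716 (1999), §1 p. 62,
§2 pp. 69–75; Silverman, *AEC* 2nd ed., VII.2.1, VII.4.1; Neukirch, *ANT* II (4.8), (9.3).
-/

noncomputable section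

open scoped Classical AddSubgroup NNReal

open NumberField IsDedekindDomain Field
open Literature.NumberTheory.EllipticCurves Literature.NumberTheory.EllipticCurves.GreenbergSelmer
  Literature.NumberTheory.GaloisRepresentations IsDedekindDomain.HeightOneSpectrum
  Summit.BirchSwinnertonDyer.Rank1Residual.X2.GreenbergVatsalTorsion
open WeierstrassCurve (minimalDiscriminantInt integralModelInt)

universe u

namespace Summit.BirchSwinnertonDyer.Rank1Residual.X2.GreenbergVatsalReductionDatum

/-! ## §1. The spectral valuation `|·|_v` on `K̄_v`, chosen once -/

section SpecVal

variable {K : Type u} [Field K] [NumberField K] (v : HeightOneSpectrum (𝓞 K))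

/-- **The spectral valuation `|·|_v` on `K̄_v`** (a choice from the tree's
`exists_spectralValuation`; the choice is immaterial: its values are the spectral norm,
`specVal_spec`). [cite: NeukirchANT1999, Ch. II Thm. (4.8)] -/
def specVal : Valuation (AlgebraicClosure (v.adicCompletion K)) ℝ≥0 :=
  v.exists_spectralValuation.choose

/-- `specVal v` computes the spectral norm. [cite: NeukirchANT1999, Ch. II Thm. (4.8)] -/
theorem specVal_spec : ∀ x : AlgebraicClosure (v.adicCompletion K),
    (specVal v x : ℝ) = spectralNorm (v.adicCompletion K) (AlgebraicClosure (v.adicCompletion K)) x :=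
  v.exists_spectralValuation.choose_spec

end SpecVal

/-! ## §2. The reduction map `E(K̄_v) → Ẽ(k̄_v)` of a globally minimal `E/ℚ` at a good prime -/

section Red

variable (W : WeierstrassCurve ℚ) [W.IsGloballyMinimal] (p : ℕ) [Fact p.Prime]
  {v : HeightOneSpectrum (𝓞 ℚ)}

/-- **The reduction map `red_v : E(K̄_v) →+ Ẽ(k̄_v)`** at the place `v ∋ p` of a globally minimal
`E/ℚ` with `p ∤ Δ_E`: the good-reduction homomorphism (`goodReductionHom`, Silverman VII.2.1) of the
minimal model `W_ℤ ⊗ 𝒪_w` over the valuation ring `𝒪_w` of `|·|_v` on `K̄_v`, transported along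
`W_ℤ ⊗ K̄_v = E ⊗ K̄_v` (`localIntModel_baseChange`) — the map `red₀` of the tree's
`OrdinaryLocalReductionMapProofs` / `SelmerCorankControlRatOrdinaryProofs`, packaged as a definition.
[cite: SilvermanAEC2009, Prop. VII.2.1] -/
def localRed (hpv : ((p : ℕ) : 𝓞 ℚ) ∈ v.asIdeal) (hΔ : ¬ (p : ℤ) ∣ minimalDiscriminantInt W) :
    localPoints W (v.adicCompletion ℚ) →+
      (((integralModelInt W).map (algebraMap ℤ ↥(specVal v).valuationSubring)).map
        (IsLocalRing.residue ↥(specVal v).valuationSubring)).toAffine.Point :=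
  (goodReductionHom _ (Valuation.valuationSubring.integers (specVal v))
      (W.isUnit_Δ_localIntModel hpv (specVal_spec v) hΔ)).comp
    (WeierstrassCurve.Affine.Point.congrEquiv (W.localIntModel_baseChange (specVal v).valuationSubring).symm).toAddMonoidHom

/-- `red_v P` is the tree's `reducePoint` of the transported point (the shape `hred₀` of
`OrdinaryLocalReductionMapProofs`). [cite: SilvermanAEC2009, Prop. VII.2.1] -/
theorem localRed_apply (hpv : ((p : ℕ) : 𝓞 ℚ) ∈ v.asIdeal) (hΔ : ¬ (p : ℤ) ∣ minimalDiscriminantInt W)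
    (P : localPoints W (v.adicCompletion ℚ)) :
    localRed W p hpv hΔ P =
      ((integralModelInt W).map (algebraMap ℤ ↥(specVal v).valuationSubring)).reducePoint
        (WeierstrassCurve.Affine.Point.congrEquiv (W.localIntModel_baseChange (specVal v).valuationSubring).symm P) :=
  rfl

/-- **`ker red_v` is `Γ_{ℚ_v}`-stable**: `red_v (σQ) = 0 ↔ red_v Q = 0` (tree:
`localRed_smul_eq_zero_iff`). [cite: SilvermanAEC2009, VII.§2] -/
theorem localRed_smul_eq_zero_iff (hpv : ((p : ℕ) : 𝓞 ℚ) ∈ v.asIdeal)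
    (hΔ : ¬ (p : ℤ) ∣ minimalDiscriminantInt W) (σ : absoluteGaloisGroup (v.adicCompletion ℚ))
    (Q : localPoints W (v.adicCompletion ℚ)) :
    localRed W p hpv hΔ (σ • Q) = 0 ↔ localRed W p hpv hΔ Q = 0 :=
  W.localRed_smul_eq_zero_iff (specVal_spec v) (W.isUnit_Δ_localIntModel hpv (specVal_spec v) hΔ)
    (localRed W p hpv hΔ) (fun _ ↦ rfl) σ Q

/-- **The local INERTIA group does not change the reduction: `red_v (σQ) = red_v Q` for
`σ ∈ I_{ℚ_v}`** (`σ` moves `𝒪_w`-integers within `𝔪_w` — `mem_inertia_iff_spectralValuation` with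
`I_𝔐 = absInertia`, `inertia_eq_absInertia` — so the integral coordinates of `Q` have the same
residues, `reducePoint_congrEquiv_smul_eq_of_val`). This is "the inertia group acts trivially on
`Ẽ(k̄_v)`", i.e. on Greenberg's `D`. [cite: SilvermanAEC2009, VII.§2 and VII.4.1] -/
theorem localRed_smul_of_mem_absInertia (hpv : ((p : ℕ) : 𝓞 ℚ) ∈ v.asIdeal)
    (hΔ : ¬ (p : ℤ) ∣ minimalDiscriminantInt W) {σ : absoluteGaloisGroup (v.adicCompletion ℚ)}
    (hσ : σ ∈ absInertia (v.adicCompletion ℚ)) (Q : localPoints W (v.adicCompletion ℚ)) :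
    localRed W p hpv hΔ (σ • Q) = localRed W p hpv hΔ Q := by
  obtain ⟨𝔐, h𝔐⟩ := v.localPrimesAbove_nonempty
  have hσ' : σ ∈ 𝔐.inertia (absoluteGaloisGroup (v.adicCompletion ℚ)) := by
    rw [inertia_eq_absInertia (specVal_spec v) h𝔐]; exact hσ
  have hmove := (mem_inertia_iff_spectralValuation (specVal_spec v) h𝔐).1 hσ'
  rw [localRed_apply, localRed_apply]
  exact reducePoint_congrEquiv_smul_eq_of_val (specVal_spec v) (W.localIntModel_baseChange _) σ Q
    (fun x y _ _ ↦ ⟨hmove x, hmove y⟩)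

omit [W.IsGloballyMinimal] [Fact p.Prime] in
/-- `E(K̄) → E(K̄_v)` intertwines `res σ ∈ D_v` with `σ ∈ Γ_{ℚ_v}` (`pointsMap_smul`, with the tree's
two names `resGal = absGaloisRestrict` for the same restriction). [folklore] -/
theorem pointsMap_absGaloisRestrict_smul {K : Type u} [Field K] (V : WeierstrassCurve K)
    (E : Type u) [Field E] [Algebra K E] (σ : absoluteGaloisGroup E) (P : V.geomPoints) :
    pointsMap V E (absGaloisRestrict K E σ • P) = σ • pointsMap V E P :=
  pointsMap_smul V E σ P

/-! ## §3. Greenberg's datum `C_v = E[p^∞] ∩ ker red_v` -/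

/-- **Greenberg's ordinary datum at a good prime `v ∋ p` of `E/ℚ`: `C_v = ker (E[p^∞] → Ẽ(k̄_v))`**,
the `p`-power torsion of the kernel of reduction `E₁` (= of the formal group; at a good ORDINARY `p`
this is Greenberg's `ℱ[p^∞] ≅ ℚ_p/ℤ_p`, LNM 1716 §1 p. 62, §2 p. 70: `0 → ℱ[p^∞] → E[p^∞] → Ẽ[p^∞] → 0`;
Greenberg–Vatsal's `C` with `D = A/C = Ẽ[p^∞]`, p. 14), as a `LocalDatum` of the tree's
`GreenbergSelmer`: `D_v`-stable because `ker red_v` is `Γ_{ℚ_v}`-stable.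
[cite: GreenbergLNM1716, §1 p. 62 and §2 p. 70] [cite: GreenbergVatsal2000, §2 p. 14] -/
def reductionDatum (hpv : ((p : ℕ) : 𝓞 ℚ) ∈ v.asIdeal) (hΔ : ¬ (p : ℤ) ∣ minimalDiscriminantInt W) :
    LocalDatum ℚ (W.geomPrimaryTorsion p) v where
  plus := ((localRed W p hpv hΔ).comp
    ((pointsMap W (v.adicCompletion ℚ)).comp (W.geomPrimaryTorsion p).subtype)).ker
  smul_mem σ {m} hm := by
    rw [AddMonoidHom.mem_ker, AddMonoidHom.comp_apply, AddMonoidHom.comp_apply,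
      AddSubgroup.coe_subtype] at hm ⊢
    rw [primaryComponent.coe_smul, pointsMap_absGaloisRestrict_smul, localRed_smul_eq_zero_iff]
    exact hm

/-- Membership in `C_v`: `m ∈ C_v ↔ red_v (ι m) = 0`. [cite: GreenbergLNM1716, §2 p. 70] -/
theorem mem_reductionDatum_plus_iff (hpv : ((p : ℕ) : 𝓞 ℚ) ∈ v.asIdeal)
    (hΔ : ¬ (p : ℤ) ∣ minimalDiscriminantInt W) (m : W.geomPrimaryTorsion p) :
    m ∈ (reductionDatum W p hpv hΔ).plus ↔
      localRed W p hpv hΔ (pointsMap W (v.adicCompletion ℚ) (m : W.geomPoints)) = 0 :=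
  Iff.rfl

/-- **GV's hypothesis "`I_p` acts trivially on `D`" HOLDS for Greenberg's datum** (`htriv` of
`GreenbergVatsalTorsion.natCard_gvSelmer_torsion*`): for `x ∈ I_v` and `m ∈ E[p^∞]`,
`x•m - m ∈ C_v`, because the local inertia group does not change reductions
(`localRed_smul_of_mem_absInertia`). GV p. 14 (good ordinary: "`D = Ẽ[p^∞]` … unramified"),
p. 26 ("assume that `I_p` acts trivially on `D`"). [cite: GreenbergVatsal2000, §2 p. 14 and Prop. (2.8)] -/
theorem reductionDatum_htriv (hpv : ((p : ℕ) : 𝓞 ℚ) ∈ v.asIdeal)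
    (hΔ : ¬ (p : ℤ) ∣ minimalDiscriminantInt W) :
    ∀ x ∈ inertia v, ∀ m : W.geomPrimaryTorsion p, x • m - m ∈ (reductionDatum W p hpv hΔ).plus := by
  intro x hx m
  obtain ⟨σ, hσ, rfl⟩ := Subgroup.mem_map.1 hx
  rw [mem_reductionDatum_plus_iff, AddSubgroupClass.coe_sub, primaryComponent.coe_smul, map_sub]
  change localRed W p hpv hΔ (pointsMap W (v.adicCompletion ℚ)
    (absGaloisRestrict ℚ (v.adicCompletion ℚ) σ • (m : W.geomPoints)) - _) = 0
  rw [pointsMap_absGaloisRestrict_smul, map_sub, localRed_smul_of_mem_absInertia W p hpv hΔ hσ,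
    sub_self]

/-- **The KUMMER COMPATIBILITY of Greenberg's datum** (hypothesis `hL` of
`GreenbergVatsalSelmerLink.selmerGroupOver_le_gvSelmer`): a torsion point of the form `σP - P` with
`σ` in the local inertia group and `P ∈ E(K̄_v)` ARBITRARY lies in `C_v` — `red_v(σP - P) =
red_v(σP) - red_v(P) = 0`. This is Greenberg's "`Im κ_{v} ⊆ Im(H¹(C) → H¹(A))`" step at `v ∣ p`
(LNM 1716 §2, Props. 2.2/2.4) in the one direction needed for `Sel_E(L) ⊆ S_A(L)`.
[cite: GreenbergLNM1716, §2 pp. 70–75] -/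
theorem reductionDatum_kummer (hpv : ((p : ℕ) : 𝓞 ℚ) ∈ v.asIdeal)
    (hΔ : ¬ (p : ℤ) ∣ minimalDiscriminantInt W) :
    ∀ σ ∈ absInertia (v.adicCompletion ℚ), ∀ (P : localPoints W (v.adicCompletion ℚ))
      (m : W.geomPrimaryTorsion p),
      pointsMap W (v.adicCompletion ℚ) (m : W.geomPoints) = σ • P - P →
        m ∈ (reductionDatum W p hpv hΔ).plus := by
  intro σ hσ P m hm
  rw [mem_reductionDatum_plus_iff, hm, map_sub, localRed_smul_of_mem_absInertia W p hpv hΔ hσ,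
    sub_self]

/-- **Greenberg's data above `p`** for a globally minimal `E/ℚ` with `p ∤ Δ_E` (one place `v ∋ p`).
[cite: GreenbergLNM1716, §2 p. 70] -/
def reductionData (hΔ : ¬ (p : ℤ) ∣ minimalDiscriminantInt W) : Data ℚ (W.geomPrimaryTorsion p) p :=
  fun _ hv ↦ reductionDatum W p hv hΔ

/-- `htriv` for the data. [cite: GreenbergVatsal2000, §2 Prop. (2.8)] -/
theorem reductionData_htriv (hΔ : ¬ (p : ℤ) ∣ minimalDiscriminantInt W) :
    ∀ (v : HeightOneSpectrum (𝓞 ℚ)) (hv : ((p : ℕ) : 𝓞 ℚ) ∈ v.asIdeal),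
      ∀ x ∈ inertia v, ∀ m : W.geomPrimaryTorsion p, x • m - m ∈ (reductionData W p hΔ v hv).plus :=
  fun _ hv ↦ reductionDatum_htriv W p hv hΔ

/-- Kummer compatibility for the data. [cite: GreenbergLNM1716, §2 pp. 70–75] -/
theorem reductionData_kummer (hΔ : ¬ (p : ℤ) ∣ minimalDiscriminantInt W) :
    ∀ (v : HeightOneSpectrum (𝓞 ℚ)) (hv : ((p : ℕ) : 𝓞 ℚ) ∈ v.asIdeal),
      ∀ σ ∈ absInertia (v.adicCompletion ℚ), ∀ (P : localPoints W (v.adicCompletion ℚ))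
        (m : W.geomPrimaryTorsion p),
        pointsMap W (v.adicCompletion ℚ) (m : W.geomPoints) = σ • P - P →
          m ∈ (reductionData W p hΔ v hv).plus :=
  fun _ hv ↦ reductionDatum_kummer W p hv hΔ

end Red

/-! ## §4. The comparison theorem of gen 8 with `htriv` DISCHARGED -/

section Card

variable (W : WeierstrassCurve ℚ) [W.IsElliptic] [W.IsGloballyMinimal] {p : ℕ} [Fact p.Prime]
  (κ : ZpExtension ℚ p) (S₀ : Set (HeightOneSpectrum (𝓞 ℚ)))

/-- **`#S^{Σ₀}_{E[p]}(ℚ_∞) = #S^{Σ₀}_{E[p^∞]}(ℚ_∞)[p] · #E(ℚ_∞)[p^∞][p]` for GREENBERG'S OWN DATUM,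
with NO hypothesis left on the datum**: `E/ℚ` globally minimal, `p` odd of good ordinary reduction
(anomalous allowed), `κ` cyclotomic, `Σ₀ ⊇` the bad primes; `htriv` is `reductionData_htriv`. The
remaining per-pair inputs of route G are the PRINTED λ-bookkeeping facts (GV Cor. 2.3/Prop. 2.4/2.5,
pp. 14–15; Greenberg 1999 §2) — see `GreenbergVatsalSelmerLink`.
[cite: GreenbergVatsal2000, §2 Prop. (2.8)] [cite: GreenbergLNM1716, §1 p. 62] -/
theorem natCard_gvSelmerInfty_torsion_reductionData (hp : p ≠ 2)
    (hgood : W.HasGoodReductionAtPrime p) (hord : ¬ (p : ℤ) ∣ W.frobeniusTrace p)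
    (hκ : κ.IsCyclotomic)
    (hS : ∀ v : HeightOneSpectrum (𝓞 ℚ), v ∉ S₀ → ((p : ℕ) : 𝓞 ℚ) ∉ v.asIdeal →
      W.HasGoodReductionAt v) :
    Nat.card (gvSelmerInfty κ ((W.geomPrimaryTorsion p)[(p : ℤ)])
        (torsionData (reductionData W p
          (W.not_dvd_minimalDiscriminantInt_of_hasGoodReductionAtPrime' p hgood)) p) S₀) =
      Nat.card (gvSelmerInfty κ (W.geomPrimaryTorsion p)
          (reductionData W p (W.not_dvd_minimalDiscriminantInt_of_hasGoodReductionAtPrime' p hgood))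
          S₀ ⊓ (subgroupH1 κ.kerSubgroup (W.geomPrimaryTorsion p))[(p : ℤ)] :
          AddSubgroup (subgroupH1 κ.kerSubgroup (W.geomPrimaryTorsion p))) *
        Nat.card ((FixedPoints.addSubgroup κ.kerSubgroup (W.geomPrimaryTorsion p))[(p : ℤ)]) :=
  GreenbergVatsalTorsionCurve.natCard_gvSelmerInfty_torsion_rat_goodOrdinary W κ _ S₀ hp hgood hord
    hκ hS (reductionData_htriv W p _)

end Card

/-! ## §5. The link, UNCONDITIONALLY, over `ℚ`: `Sel_{p^∞}(E/ℚ_∞) ⊆ S^{Σ₀}_{E[p^∞]}(ℚ_∞)` for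
Greenberg's own datum -/

section Link

variable (W : WeierstrassCurve ℚ) [W.IsElliptic] [W.IsGloballyMinimal] (p : ℕ) [Fact p.Prime]
  (S₀ : Set (HeightOneSpectrum (𝓞 ℚ)))

/-- **`Sel_{p^∞}(E/L) ⊆ S^{Σ₀}_{E[p^∞]}(L)` over every `L = ℚ̄^H` for Greenberg's datum** of a good
prime `p` of the globally minimal `E/ℚ` and every `Σ₀ ⊇` bad primes `≠ p`: NO hypothesis is left on
the datum (`reductionData_kummer`). [cite: GreenbergVatsal2000, §2 p. 19, (6)]
[cite: GreenbergLNM1716, §2 pp. 69–75] -/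
theorem selmerGroupOver_le_gvSelmer_reductionData (H : Subgroup (absoluteGaloisGroup ℚ)) [H.Normal]
    (hΔ : ¬ (p : ℤ) ∣ minimalDiscriminantInt W)
    (hS : ∀ v : HeightOneSpectrum (𝓞 ℚ), v ∉ S₀ → ((p : ℕ) : 𝓞 ℚ) ∉ v.asIdeal →
      W.HasGoodReductionAt v) :
    W.selmerGroupOver p H ≤ gvSelmer H (W.geomPrimaryTorsion p) p (reductionData W p hΔ) S₀ :=
  GreenbergVatsalSelmerLink.selmerGroupOver_le_gvSelmer W p H (reductionData W p hΔ) S₀ hS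
    (reductionData_kummer W p hΔ)

/-- **THE DUAL LINK over `ℚ_∞` (referee R102.2 (b)): `WeierstrassCurve.selmerInfty κ` — the Selmer
group whose Pontryagin dual is the `D.X` of `SelmerDualData` / `CongruentLambdaShift` — is contained
in `gvSelmerInfty κ E[p^∞] (Greenberg's datum) Σ₀`, the object of the kernel comparison theorem
`natCard_gvSelmerInfty_torsion_reductionData`, for every `ℤ_p`-extension `κ` of `ℚ`, every good `p`
and every `Σ₀ ⊇` bad primes.** What separates the two groups is PRINTED: corank `0` at good ordinary
`p` (Greenberg LNM 1716 Props. 2.1–2.4: `Sel_E(ℚ_∞)_p = S_A(ℚ_∞)`; GV Cor. 2.3/Prop. 2.4 for the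
`Σ₀`-part: `λ^{Σ₀} = λ + Σ_{ℓ∈Σ₀} s_ℓ d_ℓ`, `μ^{Σ₀} = μ`). [cite: GreenbergVatsal2000, §2 p. 19, (6)–(9)]
[cite: GreenbergLNM1716, §2 pp. 69–75] -/
theorem selmerInfty_le_gvSelmerInfty_reductionData (κ : ZpExtension ℚ p)
    (hΔ : ¬ (p : ℤ) ∣ minimalDiscriminantInt W)
    (hS : ∀ v : HeightOneSpectrum (𝓞 ℚ), v ∉ S₀ → ((p : ℕ) : 𝓞 ℚ) ∉ v.asIdeal →
      W.HasGoodReductionAt v) :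
    W.selmerInfty κ ≤ gvSelmerInfty κ (W.geomPrimaryTorsion p) (reductionData W p hΔ) S₀ :=
  GreenbergVatsalSelmerLink.selmerInfty_le_gvSelmerInfty W p (reductionData W p hΔ) S₀ κ hS
    (reductionData_kummer W p hΔ)

/-- The same from the cell's hypothesis `W.HasGoodReductionAtPrime p`.
[cite: GreenbergVatsal2000, §2 p. 19, (6)] -/
theorem selmerInfty_le_gvSelmerInfty_of_hasGoodReductionAtPrime (κ : ZpExtension ℚ p)
    (hgood : W.HasGoodReductionAtPrime p)
    (hS : ∀ v : HeightOneSpectrum (𝓞 ℚ), v ∉ S₀ → ((p : ℕ) : 𝓞 ℚ) ∉ v.asIdeal →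
      W.HasGoodReductionAt v) :
    W.selmerInfty κ ≤ gvSelmerInfty κ (W.geomPrimaryTorsion p)
      (reductionData W p (W.not_dvd_minimalDiscriminantInt_of_hasGoodReductionAtPrime' p hgood)) S₀ :=
  selmerInfty_le_gvSelmerInfty_reductionData W p S₀ κ _ hS

end Link

end Summit.BirchSwinnertonDyer.Rank1Residual.X2.GreenbergVatsalReductionDatum

end
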